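import Summits.Ventures.DiscreteObjects.UnitDistance.QuadraticPlanesFourG
import Summits.Ventures.DiscreteObjects.UnitDistance.PlaneSqrt155Four
import Summits.Ventures.DiscreteObjects.UnitDistance.PlaneSqrt203Four
import Summits.Ventures.DiscreteObjects.UnitDistance.PlaneSqrt263Four
import HarnessLib

/-!
# Quadratic planes with chromatic number four, VIII: `d = 155, 203, 263` and the ledger of open rows below `400`
(cell `pub-namedobj`, target (U), seat udg g16 — summary)

Framing (verbatim for the cell): lottery ticket; floor = certified bounds/negative ranges.

Three more rows of the quadratic table are exact: `χ(ℚ(√155)²) = χ(ℚ(√203)²) = χ(ℚ(√263)²) = 4` (`PlaneSqrt155Four.lean`: `W₁₅₅` on `1039` vertices,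
a 496-step kernel RUP certificate in four pieces, upper bound the 2-adic criterion; `PlaneSqrt203Four.lean`: `W₂₀₃` on `758` vertices, 169 steps in two
pieces, upper bound the ramified `7`-adic frame `+7` (`203 = 7 · 29`); `PlaneSqrt263Four.lean`: `W₂₆₃` on `589` vertices, 157 steps in two pieces, upper bound
the `7`-adic criterion, `263 ≡ 2² (mod 7)`).  All three witnesses come from balls of radius `3` or `4` of the Cayley graph of `ℚ(√d)²` on a DENSE generator
set — every primitive unit vector whose denominator divides one common `L` (`270` for `155`, `4770` for `203`, eleven denominators for `263`) — where the
sparse families of udg g13–g15 (the denominators of the shortest odd cycles only) gave 3-colourable balls up to `10⁶` points; several of those sparse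
sub-families are even periodically 3-colourable (udg g15).  With `155` the second century of the table has two open rows left (`107`, `167`) besides
`143 ∈ {4, 5}`; below `100` only `83` (and `47 ∈ {4, 5}`).

CONSEQUENCES.  `quadratic_table_three_mod_four_lt_200'`: for the forty-two square-free `d ≡ 3 (mod 4)` below `200`, `χ(ℚ(√d)²) = 3` for the twenty-six
`d ≢ 2 (mod 3)`, `= 4` for `d = 11, 23, 35, 59, 71, 95, 119, 131, 155, 179, 191`, `∈ {4, 5}` for `47, 143`, `∈ {3, 4}` for `83, 107`, and `3 ≤ χ ≤ 7` for `167`.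
`quadratic_open_rows_lt_400'`: the seventeen rows below `400` that are still not exact, with the interval the tree proves — `{3, 4}` for
`83, 107, 227, 251, 287, 299, 323, 347, 371, 395`; `{4, 5}` for `47, 143, 311, 335`; `[3, 5]` for `215, 383`; `[3, 7]` for `167`.  Fifteen exact rows with value
four are now in the tree (`chromaticNumber_plane_multiSqrtField_eq_four_fifteen`).  NOT in the kernel: udg g16 also found unit-distance graphs over
`ℚ(√299)` and `ℚ(√287)` that are not 3-colourable (`299`: the union of the radius-5 ball of the denominators `{18, 78, 90}` and a dense radius-3 ball, 1,041,381
points, exact core 2,331 vertices / 7,244 edges, denominator `1170`; `287`: the radius-4 ball of `{1, 24, 36, 120}`, 559,509 points, core ≈ 2,500 vertices,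
denominator `360`), each refuted by CDCL with a strictly re-checked RUP proof of ≈ 4–7·10⁵ numbers — too large for this certificate format; so
`χ(ℚ(√299)²) = 4` and `χ(ℚ(√287)²) = 4` are computations of the cell, not theorems of the tree, and both rows stay in the `{3, 4}` list below.  Values `≥ 4` not found in print (PROVISIONAL).
-/

noncomputable section

namespace Summit.Ventures.DiscreteObjects.UnitDistance

open SimpleGraph IntermediateField
open scoped IntermediateField

/-- THREE MORE EXACT QUADRATIC ROWS: `χ(ℚ(√155)²) = χ(ℚ(√203)²) = χ(ℚ(√263)²) = 4`. -/
theorem chromaticNumber_plane_sqrt_155_203_263 :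
    (planeUnitDistanceGraph.induce (fieldPoints ℚ⟮Real.sqrt 155⟯)).chromaticNumber = 4 ∧
    (planeUnitDistanceGraph.induce (fieldPoints ℚ⟮Real.sqrt 203⟯)).chromaticNumber = 4 ∧
    (planeUnitDistanceGraph.induce (fieldPoints ℚ⟮Real.sqrt 263⟯)).chromaticNumber = 4 :=
  ⟨chromaticNumber_plane_sqrt155, chromaticNumber_plane_sqrt203, chromaticNumber_plane_sqrt263⟩

/-- The fifteen exact rows with value four now in the tree (`11, 23, 35, 59, 71, 95, 119, 131, 179, 191` of udg g12–g14; `239, 359` of udg g15;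
`155, 203, 263` of udg g16), atlas vocabulary. -/
theorem chromaticNumber_plane_multiSqrtField_eq_four_fifteen :
    ∀ d ∈ ({11, 23, 35, 59, 71, 95, 119, 131, 155, 179, 191, 203, 239, 263, 359} : Finset ℕ),
      (planeUnitDistanceGraph.induce (fieldPoints (multiSqrtField {d}))).chromaticNumber = 4 := by
  intro d hd
  simp only [Finset.mem_insert, Finset.mem_singleton] at hd
  rcases hd with rfl | rfl | rfl | rfl | rfl | rfl | rfl | rfl | rfl | rfl | rfl | rfl | rfl | rfl | rfl
  · exact chromaticNumber_plane_multiSqrtField_11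
  · exact chromaticNumber_plane_multiSqrtField_23
  · exact chromaticNumber_plane_multiSqrtField_35
  · exact chromaticNumber_plane_multiSqrtField_59
  · exact chromaticNumber_plane_multiSqrtField_71
  · exact chromaticNumber_plane_multiSqrtField_95
  · exact chromaticNumber_plane_multiSqrtField_119
  · exact chromaticNumber_plane_multiSqrtField_131
  · exact chromaticNumber_plane_multiSqrtField_155
  · exact chromaticNumber_plane_multiSqrtField_179
  · exact chromaticNumber_plane_multiSqrtField_191
  · exact chromaticNumber_plane_multiSqrtField_203
  · exact chromaticNumber_plane_multiSqrtField_239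
  · exact chromaticNumber_plane_multiSqrtField_263
  · exact chromaticNumber_plane_multiSqrtField_359

/-- THE QUADRATIC TABLE FOR SQUARE-FREE `d ≡ 3 (mod 4)` BELOW `200`, AMENDED (forty-two values): `= 3` for the twenty-six `d ≢ 2 (mod 3)`; `= 4` for the
eleven `d = 11, 23, 35, 59, 71, 95, 119, 131, 155, 179, 191`; `∈ {4, 5}` for `47, 143`; not `2`-colourable and `4`-colourable for `83, 107`; not `2`-colourable
and `≤ 7` for `167`. -/
theorem quadratic_table_three_mod_four_lt_200' :
    (∀ d ∈ ({3, 7, 15, 19, 31, 39, 43, 51, 55, 67, 79, 87, 91, 103, 111, 115, 123, 127, 139, 151, 159, 163, 183, 187, 195, 199} : Finset ℕ),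
        (planeUnitDistanceGraph.induce (fieldPoints (multiSqrtField {d}))).chromaticNumber = 3) ∧
    (∀ d ∈ ({11, 23, 35, 59, 71, 95, 119, 131, 155, 179, 191} : Finset ℕ),
        (planeUnitDistanceGraph.induce (fieldPoints (multiSqrtField {d}))).chromaticNumber = 4) ∧
    (∀ d ∈ ({47, 143} : Finset ℕ),
        4 ≤ (planeUnitDistanceGraph.induce (fieldPoints (multiSqrtField {d}))).chromaticNumber ∧
          (planeUnitDistanceGraph.induce (fieldPoints (multiSqrtField {d}))).chromaticNumber ≤ 5) ∧
    (∀ d ∈ ({83, 107} : Finset ℕ),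
        ¬ (planeUnitDistanceGraph.induce (fieldPoints (multiSqrtField {d}))).Colorable 2 ∧
          (planeUnitDistanceGraph.induce (fieldPoints (multiSqrtField {d}))).Colorable 4) ∧
    (¬ (planeUnitDistanceGraph.induce (fieldPoints (multiSqrtField {167}))).Colorable 2 ∧
      (planeUnitDistanceGraph.induce (fieldPoints (multiSqrtField {167}))).chromaticNumber ≤ 7) := by
  obtain ⟨h34, h45, -, h167⟩ := quadratic_open_rows_lt_400
  refine ⟨?_, ?_, ?_, ?_, h167⟩
  · intro d hd
    simp only [Finset.mem_insert, Finset.mem_singleton] at hd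
    rcases hd with rfl | rfl | rfl | rfl | rfl | rfl | rfl | rfl | rfl | rfl | rfl | rfl | rfl | rfl | rfl | rfl | rfl | rfl | rfl | rfl |
        rfl | rfl | rfl | rfl | rfl | rfl <;>
      exact chromaticNumber_plane_eq_three_of_mem_mod_four _ (by decide) (Finset.mem_singleton_self _) (by norm_num)
  · intro d hd
    simp only [Finset.mem_insert, Finset.mem_singleton] at hd
    rcases hd with rfl | rfl | rfl | rfl | rfl | rfl | rfl | rfl | rfl | rfl | rfl
    · exact chromaticNumber_plane_multiSqrtField_11
    · exact chromaticNumber_plane_multiSqrtField_23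
    · exact chromaticNumber_plane_multiSqrtField_35
    · exact chromaticNumber_plane_multiSqrtField_59
    · exact chromaticNumber_plane_multiSqrtField_71
    · exact chromaticNumber_plane_multiSqrtField_95
    · exact chromaticNumber_plane_multiSqrtField_119
    · exact chromaticNumber_plane_multiSqrtField_131
    · exact chromaticNumber_plane_multiSqrtField_155
    · exact chromaticNumber_plane_multiSqrtField_179
    · exact chromaticNumber_plane_multiSqrtField_191
  · intro d hd
    simp only [Finset.mem_insert, Finset.mem_singleton] at hd
    rcases hd with rfl | rfl
    · exact h45 47 (by decide)
    · exact h45 143 (by decide)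
  · intro d hd
    simp only [Finset.mem_insert, Finset.mem_singleton] at hd
    rcases hd with rfl | rfl
    · exact h34 83 (by decide)
    · exact h34 107 (by decide)

/-- THE OPEN ROWS BELOW `400`, AMENDED (seventeen values; `155, 203, 263` are exact since this file): `3 ≤ χ ≤ 4` for
`83, 107, 227, 251, 287, 299, 323, 347, 371, 395`; `4 ≤ χ ≤ 5` for `47, 143, 311, 335`; `3 ≤ χ ≤ 5` for `215, 383`; `3 ≤ χ ≤ 7` for `167`.  Every other square-free
`d ≡ 3 (mod 4)` below `400` has `χ(ℚ(√d)²) = 3` (`d ≢ 2 (mod 3)`) or `= 4` (the fifteen of `chromaticNumber_plane_multiSqrtField_eq_four_fifteen`). -/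
theorem quadratic_open_rows_lt_400' :
    (∀ d ∈ ({83, 107, 227, 251, 287, 299, 323, 347, 371, 395} : Finset ℕ),
        ¬ (planeUnitDistanceGraph.induce (fieldPoints (multiSqrtField {d}))).Colorable 2 ∧
          (planeUnitDistanceGraph.induce (fieldPoints (multiSqrtField {d}))).Colorable 4) ∧
    (∀ d ∈ ({47, 143, 311, 335} : Finset ℕ),
        4 ≤ (planeUnitDistanceGraph.induce (fieldPoints (multiSqrtField {d}))).chromaticNumber ∧
          (planeUnitDistanceGraph.induce (fieldPoints (multiSqrtField {d}))).chromaticNumber ≤ 5) ∧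
    (∀ d ∈ ({215, 383} : Finset ℕ),
        ¬ (planeUnitDistanceGraph.induce (fieldPoints (multiSqrtField {d}))).Colorable 2 ∧
          (planeUnitDistanceGraph.induce (fieldPoints (multiSqrtField {d}))).Colorable 5) ∧
    (¬ (planeUnitDistanceGraph.induce (fieldPoints (multiSqrtField {167}))).Colorable 2 ∧
      (planeUnitDistanceGraph.induce (fieldPoints (multiSqrtField {167}))).chromaticNumber ≤ 7) := by
  obtain ⟨h34, h45, h35, h167⟩ := quadratic_open_rows_lt_400
  refine ⟨?_, h45, h35, h167⟩
  intro d hd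
  simp only [Finset.mem_insert, Finset.mem_singleton] at hd
  rcases hd with rfl | rfl | rfl | rfl | rfl | rfl | rfl | rfl | rfl | rfl <;> exact h34 _ (by decide)

end Summit.Ventures.DiscreteObjects.UnitDistance
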